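import Literature.Analysis.FluidPDE.NSHopfInvariant
import Summits.AnomalousDissipation.AnomalousDissipation.Theses.TwoAndHalfD

/-!
# Route TwoAndHalfD (AnomalousDissipation) — support item #4 `SymmetricLhExistence`

Settles stmt-AnomalousDissipation-0210 (`symmetric_lh_existence`): for `ν > 0`, a smooth
divergence-free steady force `f` on `𝕋³` and an `L²` weakly divergence-free datum `u₀`, both
invariant under all translations `x ↦ x + s e₃` (`s : UnitAddCircle`), the Navier–Stokes system
forced by `t ↦ f` has a global Leray–Hopf weak solution all of whose time slices are invariant
under the same translations (the "two-and-a-half-dimensional" class of Bruè–De Lellis 2023, §3.1).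

The mathematics lives entirely in `Literature/Analysis/FluidPDE`: Hopf's Faedo–Galerkin existence
proof (Hopf 1951, §§2–4; Robinson–Rodrigo–Sadowski 2016, Thm. 4.4) run inside the closed subspace
of `x₃`-independent fields is the named fact
`Literature.Analysis.FluidPDE.hopf_existence_torus_invariant` (`NSLerayHopf`), **discharged** by
`Literature.Analysis.FluidPDE.hopf_existence_torus_invariant_holds` (`NSHopfInvariant`: invariant
Galerkin scheme + invariant passage to the limit via the axis average), and its steady smooth
specialisation with this item's verbatim signature is the proved corollary
`Literature.Analysis.FluidPDE.hopf_existence_torus_invariant.symmetric_lh_existence`.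
This file is the one-line composition; the result is unconditional.
-/

namespace Summit.AnomalousDissipation.AnomalousDissipation.Theorems

-- D-0017: single-problem summit ⇒ `Summit.AnomalousDissipation.AnomalousDissipation.…` by design.
set_option linter.dupNamespace false

/-- Settles stmt-AnomalousDissipation-0210 (route `TwoAndHalfD`, support #4): `x₃`-invariant `L²`
weakly divergence-free datum and `x₃`-invariant smooth steady force admit an `x₃`-invariant global
Leray–Hopf solution on `𝕋³`. Proof: the discharged named fact
`Literature.Analysis.FluidPDE.hopf_existence_torus_invariant_holds` (Hopf 1951 §§2–4 /
Robinson–Rodrigo–Sadowski 2016 Thm. 4.4 in the invariant class) fed to the corollary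
`hopf_existence_torus_invariant.symmetric_lh_existence`, whose type is the route declaration
unfolded. [folklore] -/
theorem symmetricLhExistence_proof :
    Summit.AnomalousDissipation.AnomalousDissipation.Theses.TwoAndHalfD.SymmetricLhExistence := by
  unfold Summit.AnomalousDissipation.AnomalousDissipation.Theses.TwoAndHalfD.SymmetricLhExistence
  exact Literature.Analysis.FluidPDE.hopf_existence_torus_invariant_holds.symmetric_lh_existence

end Summit.AnomalousDissipation.AnomalousDissipation.Theorems
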